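import Literature.Barriers.QuantumAdvantage.PPolyOraclesThm76
import Literature.Computability.QuantumComplexity.OracleCoinState
import Literature.Computability.Cryptography.KitaevPhaseEstimationCircuit
import HarnessLib

/-!
# Aaronson–Chen 2017, Lemma 7.5 (2)–(3): the period-finding oracle family, I — layout, program, classical run

Topic `Literature/Barriers/QuantumAdvantage`; first file of the discharge of the named fact
`aaronsonChen2017_lem75_quantum` (`PPolyOraclesThm76.lean`): the `BQP^O` machine of the proof of
Thm. 7.6, "apply Boneh and Lipton's quantum period-finding algorithm" (App. 13, p. 42), against
the oracle encoding `acLang W` of level tables (headers `hdr n i x = 1ⁿ 0 1ⁱ 0 x`), as ONE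
poly-size Clifford+T circuit per input length `n` in Kitaev's exact form (Hadamard tests of
controlled shifts, `KitaevPhaseEstimationCircuit.kitaevCircuit`), probing every candidate block
length `b ≤ q(n)` (`ℓ` is only polynomially bounded) with `R(n)` repetitions each. This file
fixes the layout and the CLASSICAL BLOCK `V` of Kitaev's frame and computes its action on basis
states relative to an arbitrary oracle (template: `OracleCoinLayout.lean` / `OracleCoinState.lean`):

* `Shape`/`Params` (block-length bound `q`, repetitions `R`, tests factor `c₀`; a block function
  `fZ` with its value on block contents and a machine computing it) and the coin layout: block
  `s` (length `bOf s = s / R(n)`) has `bM` offset coins and `bM · 2Bt` control coins (`cOff`,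
  `cCtl`); the word of a coin string (`Shape.zOf`, `Shape.word`: block after block the shifted
  offset `(t_s + ∑ y 2^e) mod 2^{b_s}` in `bM` little-endian digits);
* the work layout (one clean block `RevClean.cleanOps` of the machine of `fZ` on the data `x cs`
  with suffix `CWrap.vg n`, its `true`-code result wires `fW k`, value slots `vW s i`, header
  constants `1ⁿ 0 1^{bM} 0` at `hBase`), the program
  `body = NOTs ++ block ++ queries ++ block ++ NOTs` (the query for bit `i` of block `s` reads
  the header wires and the result wires of the block's cells — spelling `hdr n i z_s` — and XORs
  the oracle bit into `vW s i`; the second block ERASES the read-out), well-formedness and wire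
  bounds, the circuit `V` (`RtOp.compileList`);
* **the classical run** (`w₀ … wF`, `ocEval_body`): data kept, the queried value slots hold the
  answer bits `[hdr n i z_s ∈ A]`, everything else clear; whence
  **`V_mulVec_coinInput`**: `V |x y 0…0⟩ = |x y (Rw y)⟩` relative to `A` — the hypothesis of
  Kitaev's amplitude formula.

## References

* S. Aaronson, L. Chen, *Complexity-theoretic foundations of quantum supremacy experiments*,
  CCC 2017, arXiv:1612.05903, Lemma 7.5, Thm. 7.6 (proof, p. 30), App. 13 (p. 42) [AaronsonChen2017].
* A. Yu. Kitaev, arXiv:quant-ph/9511026 (1995), §3 (Remark 8, Lemma 8, Lemma 10) [Kitaev1995].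
* E. Bernstein, U. Vazirani, SIAM J. Comput. 26 (1997), §8.3 (oracle queries on basis states)
  [BernsteinVazirani1997SICOMP].
* M. A. Nielsen, I. L. Chuang, CUP 2010, §3.2.5 (garbage-free computation) [NielsenChuang2010].
-/

noncomputable section

namespace Literature.Barriers.QuantumAdvantage

namespace Lem75Q

open _root_.Computability Literature.Computability.Complexity Literature.Computability.Cryptography
  Literature.Computability.QuantumComplexity.RevSim
  Literature.Computability.QuantumComplexity.RevClean Literature.Computability.QuantumComplexity.RazTalMachine
  Matrix Turing
open Literature.Computability.QuantumComplexity hiding natBits length_natBits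

/-! ### Shape parameters and the coin layout -/

/-- **Shape of the experiment**: the block-length bound `q` (levels `n` are probed at every block
length `b ≤ q(n)`), the repetition polynomial `R`, and the factor `c₀` of the number of Hadamard
tests per level and type. [cite: AaronsonChen2017, Lemma 7.5 (2)–(3) and App. 13 (p. 42)] -/
structure Shape where
  /-- block-length bound: probe every `b ≤ q(n)` -/
  q : Polynomial ℕ
  /-- number of repetitions of the experiment per block length -/
  R : Polynomial ℕ
  /-- tests per (level, type) are `c₀ (bM + 1)` -/
  c₀ : ℕ

namespace Shape

variable (sh : Shape) (n : ℕ)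

/-- The largest block length probed at level `n`, also the width of an offset register. [folklore] -/
def bM : ℕ := sh.q.eval n
/-- Tests per (level, type). [folklore] -/
def Bt : ℕ := sh.c₀ * (sh.bM n + 1)
/-- Coins of one block: `bM` offsets, then `bM` levels of `2 Bt` controls. [folklore] -/
def wS : ℕ := sh.bM n + sh.bM n * (2 * sh.Bt n)
/-- Repetitions per block length. [folklore] -/
def Rr : ℕ := sh.R.eval n
/-- Number of blocks: block `s` probes length `s / Rr`. [folklore] -/
def S : ℕ := (sh.bM n + 1) * sh.Rr n
/-- Number of coins. [folklore] -/
def K : ℕ := sh.S n * sh.wS n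
/-- Data wires of the clean block: input and coins. [folklore] -/
def DD : ℕ := n + sh.K n
/-- Tableau input length: data and the suffix `vg n`. [folklore] -/
def nT : ℕ := sh.DD n + (CWrap.vg n).length

/-- The block length probed by block `s`. [folklore] -/
def bOf (s : ℕ) : ℕ := s / sh.Rr n
/-- Coin index of offset bit `j` of block `s`. [folklore] -/
def cOff (s j : ℕ) : ℕ := s * sh.wS n + j
/-- Coin index of control `(e, t)` of block `s` (`t < 2 Bt`: type `t / Bt`, repetition `t % Bt`). [folklore] -/
def cCtl (s e t : ℕ) : ℕ := s * sh.wS n + sh.bM n + e * (2 * sh.Bt n) + t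

/-- Blocks probe lengths `≤ bM`. [folklore] -/
theorem bOf_le {s : ℕ} (hs : s < sh.S n) : sh.bOf n s ≤ sh.bM n := by
  unfold bOf S at *
  rcases Nat.eq_zero_or_pos (sh.Rr n) with h | h
  · rw [h] at hs; simp at hs
  · exact Nat.lt_succ_iff.1 ((Nat.div_lt_iff_lt_mul h).2 (by simpa [Nat.mul_comm] using hs))

/-! ### The word of a coin string: the shifted offsets `(t_s + A_s(y)) mod 2^{b_s}` -/

/-- The value written for block `s`: offset plus the exponent selected by the controls, modulo
`2^{b_s}` (`b_s = bOf s`; only the first `b_s` offsets and the levels `< b_s` are read).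
[cite: Kitaev1995, §3 (Lemma 10)] [cite: Shor1997, §5] -/
def zOf (cs : List Bool) (s : ℕ) : ℕ :=
  (∑ j ∈ Finset.range (sh.bOf n s), (cs.getD (sh.cOff n s j) false).toNat * 2 ^ j +
    ∑ e ∈ Finset.range (sh.bOf n s), 2 ^ e *
      ∑ t ∈ Finset.range (2 * sh.Bt n), (cs.getD (sh.cCtl n s e t) false).toNat) % 2 ^ sh.bOf n s

/-- **The word of the coin string**: block after block, the `bM`-bit little-endian numeral of `zOf`.
[folklore] -/
def word (cs : List Bool) : List Bool :=
  (List.range (sh.S n)).flatMap fun s => natBits (sh.bM n) (sh.zOf n cs s)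

/-- The word has `S · bM` bits. [folklore] -/
@[simp] theorem length_word (cs : List Bool) : (sh.word n cs).length = sh.S n * sh.bM n := by
  unfold word
  induction sh.S n with
  | zero => simp
  | succ S ih =>
    rw [List.range_succ, List.flatMap_append, List.length_append, ih]
    simp [Nat.succ_mul, length_natBits]

end Shape

/-! ### Parameters: shape, block function and its machine -/

/-- **Parameters of the family**: a shape, a string function `fZ` writing the word of the coins
behind a block content `x cs ++ vg n`, and a machine computing it within `(n+2)^e` steps.
[cite: AaronsonChen2017, Lemma 7.5 (2)–(3)] -/
structure Params extends Shape where
  /-- the block function -/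
  fZ : List Bool → List Bool
  /-- its value on block contents -/
  fZ_apply : ∀ (n : ℕ) (x cs : List Bool), x.length = n → cs.length = toShape.K n →
    fZ ((x ++ cs) ++ CWrap.vg n) = toShape.word n cs
  /-- time exponent -/
  e : ℕ
  /-- the block machine -/
  Mtm : TM2ComputableAux Bool Bool
  /-- it computes `fZ` in time `(n+2)^e` -/
  hM : ∀ u, Mtm.OutputsWithin u (fZ u) (Tn e u.length)

variable (P : Params)

/-! ### The work layout -/

section Layout

variable (n : ℕ)

/-- Width of the clean block. [folklore] -/
def Wblk : ℕ := width P.e P.Mtm (P.nT n)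
/-- The `true`-code result wire of output cell `k`. [folklore] -/
def fW (k : ℕ) : ℕ := resW P.e P.Mtm (P.nT n) k (CWrap.symTrue P.Mtm)
/-- Value slot `(s, i)`: the answer wire of the query for bit `i` of block `s`. [folklore] -/
def vW (s i : ℕ) : ℕ := Wblk P n + s * P.bM n + i
/-- Base of the header constants. [folklore] -/
def hBase : ℕ := Wblk P n + P.S n * P.bM n
/-- The header pattern `1ⁿ 0 1^{bM} 0` written at `hBase`. [folklore] -/
def hdrV : List Bool := List.replicate n true ++ false :: (List.replicate (P.bM n) true ++ [false])
/-- Number of work wires: block work wires, value slots, header. [folklore] -/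
def mW : ℕ := (Wblk P n - P.DD n) + P.S n * P.bM n + (n + P.bM n + 2)
/-- Total number of wires, in the layout form `n + (K + mW)`. [folklore] -/
abbrev NW : ℕ := n + (P.K n + mW P n)

/-- `|hdrV| = n + bM + 2`. [folklore] -/
@[simp] theorem length_hdrV : (hdrV P n).length = n + P.bM n + 2 := by
  simp [hdrV]; omega

/-- `nT = DD + 2n + 2`. [folklore] -/
theorem nT_eq : P.nT n = P.DD n + (2 * n + 2) := by simp [Shape.nT]

/-- `DD ≤ Wblk`. [folklore] -/
theorem DD_le_Wblk : P.DD n ≤ Wblk P n :=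
  le_trans (Nat.le_add_right _ _) (le_trans (le_NN (e := P.e) (M := P.Mtm) _) (NN_le_width _))

/-- `Wblk ≤ hBase`. [folklore] -/
theorem Wblk_le_hBase : Wblk P n ≤ hBase P n := Nat.le_add_right _ _

/-- **`NW = hBase + |hdrV|`.** [folklore] -/
theorem NW_eq : NW P n = hBase P n + (n + P.bM n + 2) := by
  have := DD_le_Wblk P n
  dsimp only [NW, mW, hBase, Shape.DD] at *; omega

/-- `0 < NW`. [folklore] -/
theorem NW_pos : 0 < NW P n := by rw [NW_eq]; omega

/-- `hBase + |hdrV| = NW`. [folklore] -/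
theorem hBase_add_length : hBase P n + (hdrV P n).length = NW P n := by rw [NW_eq, length_hdrV]

/-- Value slots sit above the block. [folklore] -/
theorem Wblk_le_vW (s i : ℕ) : Wblk P n ≤ vW P n s i := by unfold vW; omega

/-- Value slots sit below the header. [folklore] -/
theorem vW_lt_hBase {s i : ℕ} (hs : s < P.S n) (hi : i < P.bM n) : vW P n s i < hBase P n := by
  unfold vW hBase
  have : s * P.bM n + i < P.S n * P.bM n := by nlinarith
  omega

/-- `vW` is injective (bit index `< bM`). [folklore] -/
theorem vW_inj {s i s' i' : ℕ} (hi : i < P.bM n) (hi' : i' < P.bM n) (h : vW P n s i = vW P n s' i') :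
    s = s' ∧ i = i' := by
  unfold vW at h
  have h1 : s * P.bM n + i = s' * P.bM n + i' := by omega
  have hs : s = s' := by
    rcases lt_trichotomy s s' with hlt | heq | hgt
    · exfalso
      have : (s + 1) * P.bM n ≤ s' * P.bM n := Nat.mul_le_mul_right _ hlt
      nlinarith
    · exact heq
    · exfalso
      have : (s' + 1) * P.bM n ≤ s * P.bM n := Nat.mul_le_mul_right _ hgt
      nlinarith
  subst hs
  exact ⟨rfl, by omega⟩

/-- Result wires are inside the block. [folklore] -/
theorem fW_lt_Wblk {k : ℕ} (hk : k < JJ P.e P.Mtm (P.nT n)) : fW P n k < Wblk P n := resW_lt_width hk _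

/-- Data wires are below the result wires. [folklore] -/
theorem DD_le_fW (k : ℕ) : P.DD n ≤ fW P n k :=
  le_trans (le_trans (Nat.le_add_right _ _) (le_NN (e := P.e) (M := P.Mtm) _)) (NN_le_resW _ _ _)

/-- `fW` is injective. [folklore] -/
theorem fW_inj {k k' : ℕ} (h : fW P n k = fW P n k') : k = k' := (resW_inj h).1

/-- The word's cells are represented: `S · bM < JJ` (indeed `≤ K ≤ nT ≤ JJ`). [folklore] -/
theorem cell_lt_JJ {k : ℕ} (hk : k < P.S n * P.bM n) : k < JJ P.e P.Mtm (P.nT n) := by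
  have h1 : P.S n * P.bM n ≤ P.K n := by
    unfold Shape.K Shape.wS; exact Nat.mul_le_mul_left _ (Nat.le_add_right _ _)
  have h2 : P.K n ≤ P.nT n := by unfold Shape.nT Shape.DD; omega
  have h3 : P.nT n ≤ JJ P.e P.Mtm (P.nT n) := by unfold JJ Sn; omega
  omega

end Layout

/-! ### The program -/

section Program

variable (n : ℕ)

/-- The header constants (`NOT` gates writing `1ⁿ 0 1^{bM} 0` at `hBase`). [folklore] -/
def notsC : List (ClOp ℕ) := notsV (hBase P n) (hdrV P n)

/-- **The clean block** of the machine of `fZ` on the data wires with the suffix `vg n`.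
[cite: NielsenChuang2010, §3.2.5] -/
def blkC : List (ClOp ℕ) := cleanOps P.e P.Mtm (P.DD n) (CWrap.vg n)

/-- The query wires of the query for bit `i` of block `s`: the `n` header ones, a zero, `i` ones,
a zero, and the `b_s` result wires of the cells of block `s` — read in order they spell the
header `hdr n i z_s` of the tree's oracle encoding `acLang`. [cite: AaronsonChen2017, Thm. 7.6 (proof, p. 30)] -/
def qWires (s i : ℕ) : List ℕ :=
  (List.range n).map (hBase P n + ·) ++ [hBase P n + n] ++
    (List.range i).map (hBase P n + n + 1 + ·) ++ [hBase P n + n + 1 + P.bM n] ++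
      (List.range (P.bOf n s)).map fun j => fW P n (s * P.bM n + j)

/-- The (block, bit) pairs queried. [folklore] -/
def qPairs : List (ℕ × ℕ) := (List.range (P.S n)).flatMap fun s => (List.range (P.bOf n s)).map fun i => (s, i)

/-- **The oracle queries**: for every block `s` and bit `i < b_s`, XOR the oracle's bit
`[hdr n i z_s ∈ A]` into the value slot `(s, i)`. [cite: BernsteinVazirani1997SICOMP, §8.3 (p. 1455: the query track)] -/
def orc : List (RtOp ℕ) := (qPairs P n).map fun p => RtOp.oracle (qWires P n p.1 p.2) (vW P n p.1 p.2)

/-- **The classical part `V`**: header constants, block, queries, block (erasing the read-out),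
header constants. [cite: AaronsonChen2017, App. 13 (p. 42)] [cite: NielsenChuang2010, §3.2.5 (eq. (3.7))] -/
def body : List (RtOp ℕ) :=
  (notsC P n).map RtOp.cl ++ (blkC P n).map RtOp.cl ++ orc P n ++ (blkC P n).map RtOp.cl ++ (notsC P n).map RtOp.cl

end Program

/-! ### Well-formedness and wire bounds -/

section Bounds

variable (n : ℕ)

/-- Members of `qPairs`. [folklore] -/
theorem mem_qPairs {p : ℕ × ℕ} : p ∈ qPairs P n ↔ p.1 < P.S n ∧ p.2 < P.bOf n p.1 := by
  obtain ⟨s, i⟩ := p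
  simp [qPairs]

/-- Members of the query wires. [folklore] -/
theorem mem_qWires {s i w : ℕ} (hw : w ∈ qWires P n s i) :
    hBase P n ≤ w ∨ ∃ j < P.bOf n s, w = fW P n (s * P.bM n + j) := by
  simp only [qWires, List.mem_append, List.mem_map, List.mem_range, List.mem_singleton] at hw
  rcases hw with (((⟨j, -, rfl⟩ | rfl) | ⟨j, -, rfl⟩) | rfl) | ⟨j, hj, rfl⟩
  · left; omega
  · left; omega
  · left; omega
  · left; omega
  · right; exact ⟨j, hj, rfl⟩

/-- Query wires are inside the register. [folklore] -/
theorem qWires_lt {s i w : ℕ} (hs : s < P.S n) (hi : i < P.bOf n s) (hw : w ∈ qWires P n s i) : w < NW P n := by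
  have hb := P.bOf_le n hs
  simp only [qWires, List.mem_append, List.mem_map, List.mem_range, List.mem_singleton] at hw
  have hNW : NW P n = hBase P n + (n + P.bM n + 2) := NW_eq P n
  rcases hw with (((⟨j, hj, rfl⟩ | rfl) | ⟨j, hj, rfl⟩) | rfl) | ⟨j, hj, rfl⟩
  · omega
  · omega
  · omega
  · omega
  · have hcell : s * P.bM n + j < P.S n * P.bM n := by nlinarith
    exact lt_of_lt_of_le (fW_lt_Wblk P n (cell_lt_JJ P n hcell)) (le_trans (Wblk_le_hBase P n) (by omega))

/-- A strictly increasing list of naturals has no duplicates. [folklore] -/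
theorem nodup_of_pairwise_lt {l : List ℕ} (h : l.Pairwise (· < ·)) : l.Nodup :=
  h.imp fun hab => Nat.ne_of_lt hab

/-- Appending a larger element keeps a list strictly increasing. [folklore] -/
theorem pairwise_lt_append {l l' : List ℕ} (h : l.Pairwise (· < ·)) (h' : l'.Pairwise (· < ·))
    (hll : ∀ a ∈ l, ∀ b ∈ l', a < b) : (l ++ l').Pairwise (· < ·) :=
  List.pairwise_append.2 ⟨h, h', hll⟩

/-- The header part of the query wires, strictly increasing. [folklore] -/
theorem pairwise_hdrWires {i : ℕ} (hi : i ≤ P.bM n) :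
    ((List.range n).map (hBase P n + ·) ++ [hBase P n + n] ++
      (List.range i).map (hBase P n + n + 1 + ·) ++ [hBase P n + n + 1 + P.bM n]).Pairwise (· < ·) := by
  have hA : ((List.range n).map (hBase P n + ·)).Pairwise (· < ·) :=
    (List.pairwise_map.2 (List.pairwise_lt_range.imp fun h => by omega))
  have hB : ((List.range i).map (hBase P n + n + 1 + ·)).Pairwise (· < ·) :=
    (List.pairwise_map.2 (List.pairwise_lt_range.imp fun h => by omega))
  refine pairwise_lt_append (pairwise_lt_append (pairwise_lt_append hA (List.pairwise_singleton _ _) ?_) hB ?_)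
    (List.pairwise_singleton _ _) ?_
  · intro a ha b hb
    simp only [List.mem_map, List.mem_range, List.mem_singleton] at ha hb
    obtain ⟨j, hj, rfl⟩ := ha; subst hb; omega
  · intro a ha b hb
    simp only [List.mem_append, List.mem_map, List.mem_range, List.mem_singleton] at ha hb
    obtain ⟨j', hj', rfl⟩ := hb
    rcases ha with ⟨j, hj, rfl⟩ | rfl <;> omega
  · intro a ha b hb
    simp only [List.mem_append, List.mem_map, List.mem_range, List.mem_singleton] at ha hb
    subst hb
    rcases ha with (⟨j, hj, rfl⟩ | rfl) | ⟨j, hj, rfl⟩ <;> omega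

/-- The query wires are pairwise distinct. [folklore] -/
theorem nodup_qWires {s i : ℕ} (hs : s < P.S n) (hi : i < P.bOf n s) : (qWires P n s i).Nodup := by
  have hb := P.bOf_le n hs
  unfold qWires
  rw [List.nodup_append]
  refine ⟨nodup_of_pairwise_lt (pairwise_hdrWires P n (by omega)), ?_, ?_⟩
  · refine List.nodup_range.map_on fun a ha b hb h => ?_
    have h' := fW_inj P n h; omega
  · intro w hw w' hw' heq
    subst heq
    obtain ⟨j, hj, hje⟩ := List.mem_map.1 hw'
    rw [List.mem_range] at hj
    subst hje
    have hcell : s * P.bM n + j < P.S n * P.bM n := by nlinarith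
    have hlt := lt_of_lt_of_le (fW_lt_Wblk P n (cell_lt_JJ P n hcell)) (Wblk_le_hBase P n)
    simp only [List.mem_append, List.mem_map, List.mem_range, List.mem_singleton] at hw
    rcases hw with ((⟨j', -, h⟩ | h) | ⟨j', -, h⟩) | h <;> omega

/-- Classical operations as `RtOp`s are classical-or-query. [folklore] -/
theorem isCl_map_cl {ops : List (ClOp ℕ)} : ∀ op ∈ ops.map RtOp.cl, OSim.IsCl op := by
  intro op hop
  obtain ⟨op', -, rfl⟩ := List.mem_map.1 hop
  exact OSim.isCl_cl op'

/-- The header constants are well formed. [folklore] -/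
theorem notsC_wf : ∀ op ∈ notsC P n, op.WF := notsV_wf

/-- The header constants stay inside the register. [folklore] -/
theorem notsC_lt : ∀ op ∈ notsC P n, ∀ w ∈ wiresOf op, w < NW P n := by
  intro op hop w hw
  have := notsV_lt op hop w hw
  rw [← hBase_add_length]; exact this

/-- The block is well formed. [folklore] -/
theorem blkC_wf : ∀ op ∈ blkC P n, op.WF := cleanOps_wf

/-- The block stays inside its width. [folklore] -/
theorem blkC_lt_Wblk : ∀ op ∈ blkC P n, ∀ w ∈ wiresOf op, w < Wblk P n := by
  intro op hop i hi
  have := cleanOps_lt op hop i hi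
  simpa [Wblk, Shape.nT] using this

/-- `Wblk ≤ NW`. [folklore] -/
theorem Wblk_le_NW : Wblk P n ≤ NW P n := by rw [NW_eq]; have := Wblk_le_hBase P n; omega

/-- `hBase ≤ NW`. [folklore] -/
theorem hBase_le_NW : hBase P n ≤ NW P n := by rw [NW_eq]; omega

/-- The queries are well formed: distinct query wires, the value slot apart. [folklore] -/
theorem orc_wf : ∀ op ∈ orc P n, op.WF := by
  intro op hop
  simp only [orc, List.mem_map] at hop
  obtain ⟨⟨s, i⟩, hp, rfl⟩ := hop
  obtain ⟨hs, hi⟩ := (mem_qPairs P n).1 hp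
  dsimp only at hs hi ⊢
  change (qWires P n s i ++ [vW P n s i]).Nodup
  rw [List.nodup_append]
  refine ⟨nodup_qWires P n hs hi, List.nodup_singleton _, ?_⟩
  intro w hw v hv heq
  rw [List.mem_singleton] at hv
  subst hv; subst heq
  have h1 := Wblk_le_vW P n s i
  have h2 := vW_lt_hBase P n hs (lt_of_lt_of_le hi (P.bOf_le n hs))
  rcases mem_qWires P n hw with h | ⟨j, hj, h⟩
  · omega
  · have hcell : s * P.bM n + j < P.S n * P.bM n := by have := P.bOf_le n hs; nlinarith
    have := fW_lt_Wblk P n (cell_lt_JJ P n hcell)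
    omega

/-- The queries stay inside the register. [folklore] -/
theorem orc_lt : ∀ op ∈ orc P n, ∀ w ∈ op.wires, w < NW P n := by
  intro op hop w hw
  simp only [orc, List.mem_map] at hop
  obtain ⟨⟨s, i⟩, hp, rfl⟩ := hop
  obtain ⟨hs, hi⟩ := (mem_qPairs P n).1 hp
  dsimp only at hs hi hw ⊢
  simp only [RtOp.wires, List.mem_append, List.mem_singleton] at hw
  rcases hw with hw | rfl
  · exact qWires_lt P n hs hi hw
  · exact lt_of_lt_of_le (vW_lt_hBase P n hs (lt_of_lt_of_le hi (P.bOf_le n hs))) (hBase_le_NW P n)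

/-- The queries are classical-or-query. [folklore] -/
theorem isCl_orc : ∀ op ∈ orc P n, OSim.IsCl op := by
  intro op hop
  simp only [orc, List.mem_map] at hop
  obtain ⟨p, -, rfl⟩ := hop
  exact OSim.isCl_oracle _ _

/-- **The classical part is well formed.** [folklore] -/
theorem body_wf : ∀ op ∈ body P n, op.WF := by
  intro op hop
  simp only [body, List.mem_append] at hop
  rcases hop with (((h | h) | h) | h) | h
  · exact PhaseQuery.wf_map_cl (notsC_wf P n) op h
  · exact PhaseQuery.wf_map_cl (blkC_wf P n) op h
  · exact orc_wf P n op h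
  · exact PhaseQuery.wf_map_cl (blkC_wf P n) op h
  · exact PhaseQuery.wf_map_cl (notsC_wf P n) op h

/-- **The classical part stays inside the register.** [folklore] -/
theorem body_lt : ∀ op ∈ body P n, ∀ w ∈ op.wires, w < NW P n := by
  intro op hop
  simp only [body, List.mem_append] at hop
  have hb := PhaseQuery.lt_map_cl (fun op hop w hw => lt_of_lt_of_le (blkC_lt_Wblk P n op hop w hw) (Wblk_le_NW P n))
  rcases hop with (((h | h) | h) | h) | h
  · exact PhaseQuery.lt_map_cl (notsC_lt P n) op h
  · exact hb op h
  · exact orc_lt P n op h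
  · exact hb op h
  · exact PhaseQuery.lt_map_cl (notsC_lt P n) op h

/-- **The classical part is classical-or-query.** [folklore] -/
theorem isCl_body : ∀ op ∈ body P n, OSim.IsCl op := by
  intro op hop
  simp only [body, List.mem_append] at hop
  rcases hop with (((h | h) | h) | h) | h
  · exact isCl_map_cl op h
  · exact isCl_map_cl op h
  · exact isCl_orc P n op h
  · exact isCl_map_cl op h
  · exact isCl_map_cl op h

end Bounds

/-! ### The classical part as a circuit -/

section Circuit

variable (n : ℕ)

/-- The wire embedding `ℕ → Fin NW` (identity below `NW`). [folklore] -/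
def foW : ℕ → Fin (NW P n) := finOf (NW P n) (NW_pos P n)

/-- The classical part re-indexed to `Fin NW`. [folklore] -/
def bodyF : List (RtOp (Fin (NW P n))) := (body P n).map (RtOp.map (foW P n))

/-- The re-indexed classical part is well formed. [folklore] -/
theorem bodyF_wf : ∀ op ∈ bodyF P n, op.WF := wf_map_finOf_of (NW_pos P n) (body_wf P n) (body_lt P n)

/-- **The classical part `V` of the period-finding circuit at input length `n`.**
[cite: AaronsonChen2017, App. 13 (p. 42)] [cite: BernsteinVazirani1997SICOMP, §8.3] -/
def V : QCircuit cliffordT (n + (P.K n + mW P n)) := ⟨RtOp.compileList (bodyF P n) (bodyF_wf P n)⟩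

/-- **`V` acts classically on basis states, relative to the oracle**: `|w⟩ ↦ |ocEval A body (liftW w)⟩`.
[cite: BernsteinVazirani1997SICOMP, Thm. 8.3 (proof) and §8.3] -/
theorem V_mulVec_basisState (A : Language Bool) (w : QReg (NW P n)) :
    (V P n).toMatrix A *ᵥ basisState w = basisState fun p => OSim.ocEval A (body P n) (liftW w) p :=
  OSim.compileList_map_mulVec_basisState A (NW_pos P n) (body P n) (isCl_body P n) (body_lt P n) _ w

end Circuit

/-! ### Digits: the tree's fixed-width little-endian numerals -/

section Digits


/-- Truncating a fixed-width numeral gives the shorter numeral. [folklore] -/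
theorem take_natBits : ∀ {b D : ℕ} (_ : b ≤ D) (z : ℕ), (natBits D z).take b = natBits b z
  | 0, _, _, z => by simp [natBits]
  | b + 1, 0, h, z => by omega
  | b + 1, D + 1, h, z => by
    rw [natBits, natBits, List.take_succ_cons, take_natBits (by omega)]

/-- Reading a digit inside the width. [folklore] -/
theorem getD_natBits_eq_getD_natBits {j b D : ℕ} (hj : j < b) (hb : b ≤ D) (z : ℕ) :
    (natBits D z).getD j false = (natBits b z).getD j false := by
  rw [← take_natBits hb z, List.getD_eq_getElem?_getD, List.getD_eq_getElem?_getD, List.getElem?_take_of_lt hj]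

end Digits

/-! ### The word: cells of a block -/

section Word

variable (n : ℕ)


/-- **Cell `s · bM + j` of the word is digit `j` of block `s`.** [folklore] -/
theorem getD_word {cs : List Bool} {s j : ℕ} (hs : s < P.S n) (hj : j < P.bM n) :
    (P.word n cs).getD (s * P.bM n + j) false = (natBits (P.bM n) (P.zOf n cs s)).getD j false := by
  unfold Shape.word
  have key : ∀ (S : ℕ) (_ : s < S), ((List.range S).flatMap fun s => natBits (P.bM n) (P.zOf n cs s)).getD
      (s * P.bM n + j) false = (natBits (P.bM n) (P.zOf n cs s)).getD j false := by
    intro S hS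
    induction S with
    | zero => omega
    | succ S ih =>
      rw [List.range_succ, List.flatMap_append, List.flatMap_singleton]
      have hlen : ((List.range S).flatMap fun s => natBits (P.bM n) (P.zOf n cs s)).length = S * P.bM n := by
        clear ih hS
        induction S with
        | zero => simp
        | succ S ih' => rw [List.range_succ, List.flatMap_append, List.length_append, ih']; simp [Nat.succ_mul, length_natBits]
      rcases Nat.lt_succ_iff_lt_or_eq.1 hS with h | rfl
      · rw [List.getD_append _ _ _ _ (by rw [hlen]; nlinarith), ih h]
      · rw [List.getD_append_right _ _ _ _ (by rw [hlen]; omega), hlen]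
        congr 1
        omega
  exact key _ hs

end Word

/-! ### The classical run of `V` on `x y 0…0` -/

section Run

variable {n : ℕ} (x : QReg n) (y : QReg (P.K n)) (A : Language Bool)


/-- The data string `x y`. [folklore] -/
def dL : List Bool := List.ofFn x ++ List.ofFn y

/-- `|dL| = DD`. [folklore] -/
@[simp] theorem length_dL : (dL P x y).length = P.DD n := by simp [dL, Shape.DD]

/-- The initial assignment `x y 0…0` extended to `ℕ`. [folklore] -/
def w₀ : ℕ → Bool := liftW (coinInput (m := mW P n) x y)

/-- The initial assignment is the string assignment of `x ++ y`. [folklore] -/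
theorem w₀_apply (i : ℕ) : w₀ P x y i = (dL P x y).getD i false := by
  unfold w₀ liftW dL
  by_cases hi : i < NW P n
  · rw [dif_pos hi]
    by_cases h1 : i < n
    · have e : (⟨i, hi⟩ : Fin (NW P n)) = Fin.castAdd (P.K n + mW P n) ⟨i, h1⟩ := rfl
      rw [e, coinInput_castAdd, List.getD_append _ _ _ _ (by simpa using h1), List.getD_eq_getElem _ _ (by simpa using h1),
        List.getElem_ofFn]
    · by_cases h2 : i < n + P.K n
      · have e : (⟨i, hi⟩ : Fin (NW P n)) = coinWire n (P.K n) (mW P n) ⟨i - n, by omega⟩ := by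
          apply Fin.ext; simp [coinWire]; omega
        rw [e, coinInput_coinWire, List.getD_append_right _ _ _ _ (by simp; omega), List.length_ofFn,
          List.getD_eq_getElem _ _ (by simp; omega), List.getElem_ofFn]
      · have e : (⟨i, hi⟩ : Fin (NW P n)) = Fin.natAdd n (Fin.natAdd (P.K n) ⟨i - n - P.K n, by
            have := hi; dsimp only [NW] at this; omega⟩) := by
          apply Fin.ext; simp; omega
        rw [e, coinInput_work, List.getD_eq_default _ _ (by simp; omega)]
  · have hle : (List.ofFn x ++ List.ofFn y).length ≤ i := by
      have := DD_le_Wblk P n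
      simp only [List.length_append, List.length_ofFn]
      dsimp only [NW, Shape.DD, mW] at hi this; omega
    rw [dif_neg hi, List.getD_eq_default _ _ hle]

/-- Beyond the data the initial assignment is clear. [folklore] -/
theorem w₀_of_le {i : ℕ} (hi : P.DD n ≤ i) : w₀ P x y i = false := by
  rw [w₀_apply, List.getD_eq_default _ _ (by rw [length_dL]; exact hi)]

/-- The header pattern bit at wire `i` (zero off the header). [folklore] -/
def hbit (n i : ℕ) : Bool := decide (hBase P n ≤ i ∧ i < hBase P n + (hdrV P n).length) && (hdrV P n).getD (i - hBase P n) false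

/-- **The header constants** flip exactly the header wires carrying a `1` of the pattern. [folklore] -/
theorem clEval_notsC_apply (w : ℕ → Bool) (i : ℕ) : clEval (notsC P n) w i = (w i ^^ hbit P n i) :=
  clEval_notsV_apply _ _ w i

/-- Off the header, `hbit` vanishes. [folklore] -/
theorem hbit_of_lt {i : ℕ} (hi : i < hBase P n) : hbit P n i = false := by
  simp [hbit, not_le.2 hi]

/-- The header ones `1ⁿ`. [folklore] -/
theorem hbit_one {j : ℕ} (hj : j < n) : hbit P n (hBase P n + j) = true := by
  unfold hbit
  rw [length_hdrV, decide_eq_true (by omega), Bool.true_and, Nat.add_sub_cancel_left]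
  unfold hdrV
  rw [List.getD_append _ _ _ _ (by simpa using hj), List.getD_eq_getElem _ _ (by simpa using hj),
    List.getElem_replicate]

/-- The first zero. [folklore] -/
theorem hbit_zA : hbit P n (hBase P n + n) = false := by
  unfold hbit
  rw [Nat.add_sub_cancel_left]
  unfold hdrV
  rw [List.getD_append_right _ _ _ _ (by simp), List.length_replicate, Nat.sub_self]
  simp

/-- The middle ones `1^{bM}`. [folklore] -/
theorem hbit_mOne {j : ℕ} (hj : j < P.bM n) : hbit P n (hBase P n + n + 1 + j) = true := by
  unfold hbit
  rw [length_hdrV, decide_eq_true (by omega), Bool.true_and,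
    show hBase P n + n + 1 + j - hBase P n = n + (j + 1) by omega]
  unfold hdrV
  rw [List.getD_append_right _ _ _ _ (by simp), List.length_replicate, Nat.add_sub_cancel_left,
    List.getD_cons_succ, List.getD_append _ _ _ _ (by simpa using hj), List.getD_eq_getElem _ _ (by simpa using hj),
    List.getElem_replicate]

/-- The last zero. [folklore] -/
theorem hbit_zB : hbit P n (hBase P n + n + 1 + P.bM n) = false := by
  unfold hbit
  rw [show hBase P n + n + 1 + P.bM n - hBase P n = n + (P.bM n + 1) by omega]
  unfold hdrV
  rw [List.getD_append_right _ _ _ _ (by simp), List.length_replicate, Nat.add_sub_cancel_left,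
    List.getD_cons_succ, List.getD_append_right _ _ _ _ (by simp), List.length_replicate, Nat.sub_self]
  simp

/-- **Stage 1**: after the header constants, data below, the pattern on the header. [folklore] -/
def w₁ : ℕ → Bool := fun i => (w₀ P x y i ^^ hbit P n i)

/-- Stage 1 is the header program on the initial assignment. [folklore] -/
theorem clEval_notsC_w₀ : clEval (notsC P n) (w₀ P x y) = w₁ P x y := by
  funext i; exact clEval_notsC_apply P _ i

/-- Below the header stage 1 is the initial assignment. [folklore] -/
theorem w₁_of_lt {i : ℕ} (hi : i < hBase P n) : w₁ P x y i = w₀ P x y i := by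
  simp [w₁, hbit_of_lt P hi]

/-- On and above the header stage 1 is the pattern. [folklore] -/
theorem w₁_of_le {i : ℕ} (hi : hBase P n ≤ i) : w₁ P x y i = hbit P n i := by
  have : P.DD n ≤ i := le_trans (le_trans (DD_le_Wblk P n) (Wblk_le_hBase P n)) hi
  simp [w₁, w₀_of_le P x y this]

/-- **The block with suffix on an assignment holding a data string `d` and clear work wires.**
[cite: NielsenChuang2010, §3.2.5 (garbage-free computation)] -/
theorem clEval_blkC (d : List Bool) (hd : d.length = P.DD n) (w : ℕ → Bool)
    (h1 : ∀ i < P.DD n, w i = d.getD i false) (h2 : ∀ i, P.DD n ≤ i → i < Wblk P n → w i = false) :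
    clEval (blkC P n) w = fun i =>
      if i < Wblk P n then
        (if i < P.DD n then d.getD i false else readOut P.e P.Mtm (P.nT n) (P.fZ (d ++ CWrap.vg n)) i)
      else w i := by
  have hM' : P.Mtm.OutputsWithin (d ++ CWrap.vg n) (P.fZ (d ++ CWrap.vg n)) (Tn P.e (d.length + (CWrap.vg n).length)) := by
    have := P.hM (d ++ CWrap.vg n); rwa [List.length_append] at this
  have hcan := clEval_cleanOps (e := P.e) (M := P.Mtm) d (CWrap.vg n) _ hM'
  rw [hd] at hcan
  change clEval (blkC P n) (strW d) = fun i => if i < P.DD n then d.getD i false else readOut P.e P.Mtm (P.nT n) _ i at hcan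
  have hagree : ∀ i, i < Wblk P n → w i = strW d i := by
    intro i hi
    by_cases hid : i < P.DD n
    · rw [h1 i hid]; rfl
    · rw [h2 i (not_lt.1 hid) hi, strW, List.getD_eq_default _ _ (by rw [hd]; exact not_lt.1 hid)]
  funext i
  by_cases hi : i < Wblk P n
  · rw [if_pos hi, clEval_agree (fun i => i < Wblk P n) _ (blkC_lt_Wblk P n) hagree i hi, hcan]
  · rw [if_neg hi]
    exact clEval_apply_of_forall_target_ne _ _ fun op hop heq =>
      hi (heq ▸ blkC_lt_Wblk P n op hop op.target (by simp [wiresOf]))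

/-- **The block run twice is the identity.** [cite: NielsenChuang2010, §3.2.5 (eq. (3.7))] -/
theorem clEval_blkC_blkC (w : ℕ → Bool) : clEval (blkC P n) (clEval (blkC P n) w) = w :=
  clEval_cleanOps_cleanOps _ _ w

/-- **Frame**: the block commutes with changes at and above its width. [folklore] -/
theorem clEval_blkC_ite (g w : ℕ → Bool) :
    clEval (blkC P n) (fun i => if Wblk P n ≤ i then g i else w i) =
      fun i => if Wblk P n ≤ i then g i else clEval (blkC P n) w i :=
  clEval_ite (fun i => Wblk P n ≤ i) _ (fun op hop =>
    ⟨fun h => absurd (blkC_lt_Wblk P n op hop op.target (by simp [wiresOf])) (not_lt.2 h),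
      fun c hc h => absurd (blkC_lt_Wblk P n op hop c (by simp [wiresOf, hc])) (not_lt.2 h)⟩) g w

/-- The block content is `dL ++ vg n` and the block function writes the word of the coins. [folklore] -/
theorem fZ_dL : P.fZ (dL P x y ++ CWrap.vg n) = P.word n (List.ofFn y) :=
  P.fZ_apply n (List.ofFn x) (List.ofFn y) (by simp) (by simp)

/-- **Stage 2**: after the first block — data, then the read-out of the word inside the block,
the pattern above. [folklore] -/
def w₂ : ℕ → Bool := fun i =>
  if i < Wblk P n then
    (if i < P.DD n then (dL P x y).getD i false else readOut P.e P.Mtm (P.nT n) (P.word n (List.ofFn y)) i)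
  else w₁ P x y i

/-- Stage 2 is the block on stage 1. [folklore] -/
theorem clEval_blkC_w₁ : clEval (blkC P n) (w₁ P x y) = w₂ P x y := by
  rw [clEval_blkC P (dL P x y) (length_dL P x y) (w₁ P x y)
    (fun i hi => by rw [w₁_of_lt P x y (lt_of_lt_of_le hi (le_trans (DD_le_Wblk P n) (Wblk_le_hBase P n))), w₀_apply])
    (fun i h1 h2 => by rw [w₁_of_lt P x y (lt_of_lt_of_le h2 (Wblk_le_hBase P n)), w₀_of_le P x y h1]), fZ_dL]
  rfl

/-- **After the first block, the result wire of a cell reads that bit of the word.** [folklore] -/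
theorem w₂_fW {s j : ℕ} (hs : s < P.S n) (hj : j < P.bM n) :
    w₂ P x y (fW P n (s * P.bM n + j)) = (natBits (P.bM n) (P.zOf n (List.ofFn y) s)).getD j false := by
  have hcell : s * P.bM n + j < P.S n * P.bM n := by nlinarith
  have hkJ := cell_lt_JJ P n hcell
  have hlen : (P.fZ (dL P x y ++ CWrap.vg n)).length = P.S n * P.bM n := by rw [fZ_dL, Shape.length_word]
  have hM := P.hM (dL P x y ++ CWrap.vg n)
  have hu : (dL P x y ++ CWrap.vg n).length = P.nT n := by rw [List.length_append, length_dL]; rfl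
  rw [hu] at hM
  unfold w₂
  rw [if_pos (fW_lt_Wblk P n hkJ), if_neg (not_lt.2 (DD_le_fW P n _)), fW, readOut_resW hkJ, ← fZ_dL,
    CWrap.outBit_symTrue_eq (e := P.e) hu hM (by rw [hlen]; exact hcell), List.getElem_of_eq (fZ_dL P x y),
    ← List.getD_eq_getElem _ false (by rw [Shape.length_word]; exact hcell)]
  exact getD_word P n hs hj

/-- After the first block the header wires carry the pattern. [folklore] -/
theorem w₂_of_hBase_le {i : ℕ} (hi : hBase P n ≤ i) : w₂ P x y i = hbit P n i := by
  unfold w₂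
  rw [if_neg (not_lt.2 (le_trans (Wblk_le_hBase P n) hi)), w₁_of_le P x y hi]

/-- After the first block the value slots are clear. [folklore] -/
theorem w₂_vW {s i : ℕ} (hs : s < P.S n) (hi : i < P.bM n) : w₂ P x y (vW P n s i) = false := by
  unfold w₂
  rw [if_neg (not_lt.2 (Wblk_le_vW P n s i)), w₁_of_lt P x y (vW_lt_hBase P n hs hi),
    w₀_of_le P x y (le_trans (DD_le_Wblk P n) (Wblk_le_vW P n s i))]

/-- **The query string of `(s, i)` after the first block is the header `hdr n i z_s`** (with `z_s`
in `b_s` little-endian digits). [cite: AaronsonChen2017, Thm. 7.6 (proof, p. 30: the oracle encodes the truth tables)] -/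
theorem map_w₂_qWires {s i : ℕ} (hs : s < P.S n) (hi : i < P.bOf n s) :
    (qWires P n s i).map (w₂ P x y) = hdr n i (natBits (P.bOf n s) (P.zOf n (List.ofFn y) s)) := by
  have hb := P.bOf_le n hs
  simp only [qWires, List.map_append, List.map_map, List.map_cons, List.map_nil, hdr, ones]
  have h1 : (List.range n).map (w₂ P x y ∘ (hBase P n + ·)) = List.replicate n true := by
    refine List.ext_getElem (by simp) fun k hk hk' => ?_
    simp only [List.getElem_map, List.getElem_range, Function.comp_apply, List.getElem_replicate]
    rw [w₂_of_hBase_le P x y (by omega), hbit_one P (by simpa using hk)]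
  have h2 : (List.range i).map (w₂ P x y ∘ (hBase P n + n + 1 + ·)) = List.replicate i true := by
    refine List.ext_getElem (by simp) fun k hk hk' => ?_
    simp only [List.getElem_map, List.getElem_range, Function.comp_apply, List.getElem_replicate]
    rw [w₂_of_hBase_le P x y (by omega), hbit_mOne P (by simp at hk; omega)]
  have h3 : (List.range (P.bOf n s)).map (w₂ P x y ∘ fun j => fW P n (s * P.bM n + j)) =
      natBits (P.bOf n s) (P.zOf n (List.ofFn y) s) := by
    refine List.ext_getElem (by simp [length_natBits]) fun k hk hk' => ?_
    simp only [List.getElem_map, List.getElem_range, Function.comp_apply]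
    have hk'' : k < P.bOf n s := by simpa using hk
    rw [w₂_fW P x y hs (lt_of_lt_of_le hk'' hb), getD_natBits_eq_getD_natBits hk'' hb,
      List.getD_eq_getElem _ _ hk']
  rw [h1, h2, h3, w₂_of_hBase_le P x y (by omega), w₂_of_hBase_le P x y (by omega), hbit_zA, hbit_zB]
  simp

end Run

/-! ### Stages 3–5: the queries, the erasing block, the header cleared -/

section Run2

variable {n : ℕ} (x : QReg n) (y : QReg (P.K n)) (A : Language Bool)

/-- **The answer bit of the query for bit `i` of block `s`**: `[hdr n i z_s ∈ A]`.
[cite: AaronsonChen2017, Thm. 7.6 (proof, p. 30)] -/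
def ans (s i : ℕ) : Bool := A.boolIndicator (hdr n i (natBits (P.bOf n s) (P.zOf n (List.ofFn y) s)))

/-- Wire `j` is a queried value slot. [folklore] -/
def IsSlot (n j : ℕ) : Prop :=
  Wblk P n ≤ j ∧ j < hBase P n ∧ (j - Wblk P n) % P.bM n < P.bOf n ((j - Wblk P n) / P.bM n)

/-- Being a queried value slot is decidable. [folklore] -/
instance IsSlot.decidable (n j : ℕ) : Decidable (IsSlot P n j) := by unfold IsSlot; infer_instance

/-- A queried value slot is a slot. [folklore] -/
theorem isSlot_vW {s i : ℕ} (hs : s < P.S n) (hi : i < P.bOf n s) : IsSlot P n (vW P n s i) := by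
  have hb := P.bOf_le n hs
  have hbM : 0 < P.bM n := by omega
  have hdiv : (vW P n s i - Wblk P n) / P.bM n = s := by
    unfold vW; rw [Nat.add_assoc, Nat.add_sub_cancel_left, Nat.add_comm, Nat.add_mul_div_right _ _ hbM,
      Nat.div_eq_of_lt (by omega), Nat.zero_add]
  have hmod : (vW P n s i - Wblk P n) % P.bM n = i := by
    unfold vW; rw [Nat.add_assoc, Nat.add_sub_cancel_left, Nat.add_comm, Nat.add_mul_mod_self_right,
      Nat.mod_eq_of_lt (by omega)]
  refine ⟨Wblk_le_vW P n s i, vW_lt_hBase P n hs (by omega), ?_⟩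
  rw [hmod, hdiv]; exact hi

/-- A slot is a queried value slot. [folklore] -/
theorem vW_of_isSlot {j : ℕ} (hj : IsSlot P n j) :
    vW P n ((j - Wblk P n) / P.bM n) ((j - Wblk P n) % P.bM n) = j ∧
      (j - Wblk P n) / P.bM n < P.S n ∧ (j - Wblk P n) % P.bM n < P.bM n := by
  obtain ⟨h1, h2, h3⟩ := hj
  have hbM : 0 < P.bM n := by
    rcases Nat.eq_zero_or_pos (P.bM n) with h | h
    · exfalso; rw [h] at h3; simp [Shape.bOf] at h3
    · exact h
  refine ⟨?_, ?_, Nat.mod_lt _ hbM⟩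
  · unfold vW; have := Nat.div_add_mod (j - Wblk P n) (P.bM n); rw [Nat.mul_comm] at this; omega
  · unfold hBase at h2
    exact (Nat.div_lt_iff_lt_mul hbM).2 (by omega)

/-- **A list of queries with pairwise distinct answer wires, none of which is a query wire**
(`OCoin.ocEval_oracles` with an arbitrary index type). [cite: BernsteinVazirani1997SICOMP, §8.3 (p. 1455)] -/
theorem ocEval_oracles {α : Type} (qs : α → List ℕ) (tg : α → ℕ) :
    ∀ (L : List α) (_ : (L.map tg).Nodup) (_ : ∀ a ∈ L, ∀ b ∈ L, tg a ∉ qs b) (w : ℕ → Bool),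
      (∀ a ∈ L, OSim.ocEval A (L.map fun a => RtOp.oracle (qs a) (tg a)) w (tg a) =
          (w (tg a) ^^ A.boolIndicator ((qs a).map w))) ∧
        ∀ i, (∀ a ∈ L, tg a ≠ i) → OSim.ocEval A (L.map fun a => RtOp.oracle (qs a) (tg a)) w i = w i
  | [], _, _, w => by simp
  | a :: L, hnd, hdis, w => by
    rw [List.map_cons, List.nodup_cons] at hnd
    have hdis' : ∀ a' ∈ L, ∀ b ∈ L, tg a' ∉ qs b := fun a' ha' b hb =>
      hdis a' (List.mem_cons_of_mem _ ha') b (List.mem_cons_of_mem _ hb)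
    set w' := OSim.ocAct A (RtOp.oracle (qs a) (tg a)) w with hw'
    obtain ⟨ih1, ih2⟩ := ocEval_oracles qs tg L hnd.2 hdis' w'
    have hstep : OSim.ocEval A ((a :: L).map fun a => RtOp.oracle (qs a) (tg a)) w =
        OSim.ocEval A (L.map fun a => RtOp.oracle (qs a) (tg a)) w' := by rw [List.map_cons, OSim.ocEval_cons]
    have hw'a : w' (tg a) = (w (tg a) ^^ A.boolIndicator ((qs a).map w)) := by simp [hw', OSim.ocAct]
    have hw'ne : ∀ i, i ≠ tg a → w' i = w i := fun i hi => by simp [hw', OSim.ocAct, Function.update_of_ne hi]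
    have hread : ∀ b ∈ a :: L, (qs b).map w' = (qs b).map w := fun b hb =>
      List.map_congr_left fun j hj => hw'ne j fun e => hdis a (by simp) b hb (e ▸ hj)
    have hnota : ∀ a' ∈ L, tg a' ≠ tg a := fun a' ha' he => hnd.1 (by rw [← he]; exact List.mem_map_of_mem ha')
    refine ⟨fun b hb => ?_, fun i hi => ?_⟩
    · rw [hstep]
      rcases List.mem_cons.1 hb with rfl | hb'
      · rw [ih2 (tg b) hnota, hw'a]
      · rw [ih1 b hb', hread b hb, hw'ne _ (hnota b hb')]
    · rw [hstep, ih2 i (fun a' ha' => hi a' (List.mem_cons_of_mem _ ha')), hw'ne i (Ne.symm (hi a (by simp)))]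

/-- **Stage 3**: after the queries — the value slots hold the answer bits. [folklore] -/
def w₃ : ℕ → Bool := fun j =>
  if IsSlot P n j then ans P y A ((j - Wblk P n) / P.bM n) ((j - Wblk P n) % P.bM n) else w₂ P x y j

/-- Stage 3 is the queries on stage 2. [cite: BernsteinVazirani1997SICOMP, §8.3 (p. 1455)] -/
theorem ocEval_orc_w₂ : OSim.ocEval A (orc P n) (w₂ P x y) = w₃ P x y A := by
  have hnd : ((qPairs P n).map fun p : ℕ × ℕ => vW P n p.1 p.2).Nodup := by
    rw [List.nodup_map_iff_inj_on]
    · rintro ⟨s, i⟩ hp ⟨s', i'⟩ hp' h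
      obtain ⟨hs, hi⟩ := (mem_qPairs P n).1 hp
      obtain ⟨hs', hi'⟩ := (mem_qPairs P n).1 hp'
      dsimp only at hs hi hs' hi' h
      obtain ⟨rfl, rfl⟩ := vW_inj P n (lt_of_lt_of_le hi (P.bOf_le n hs)) (lt_of_lt_of_le hi' (P.bOf_le n hs')) h
      rfl
    · unfold qPairs
      rw [List.nodup_flatMap]
      refine ⟨fun s _ => List.nodup_range.map_on fun a _ b _ h => by simpa using h, ?_⟩
      refine List.nodup_range.pairwise_of_forall_ne fun s _ s' _ hne => ?_
      simp only [Function.onFun, List.disjoint_left, List.mem_map, List.mem_range]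
      rintro _ ⟨i, -, rfl⟩ ⟨i', -, h⟩
      simp at h; exact hne h.1.symm
  have hdis : ∀ a ∈ qPairs P n, ∀ b ∈ qPairs P n, vW P n a.1 a.2 ∉ qWires P n b.1 b.2 := by
    rintro ⟨s, i⟩ hp ⟨s', i'⟩ hp' hmem
    obtain ⟨hs, hi⟩ := (mem_qPairs P n).1 hp
    obtain ⟨hs', hi'⟩ := (mem_qPairs P n).1 hp'
    dsimp only at hs hi hs' hi' hmem
    have h1 := Wblk_le_vW P n s i
    have h2 := vW_lt_hBase P n hs (lt_of_lt_of_le hi (P.bOf_le n hs))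
    rcases mem_qWires P n hmem with h | ⟨j, hj, h⟩
    · omega
    · have hcell : s' * P.bM n + j < P.S n * P.bM n := by have := P.bOf_le n hs'; nlinarith
      have := fW_lt_Wblk P n (cell_lt_JJ P n hcell)
      omega
  obtain ⟨k1, k2⟩ := ocEval_oracles A (fun p : ℕ × ℕ => qWires P n p.1 p.2) (fun p => vW P n p.1 p.2)
    (qPairs P n) hnd hdis (w₂ P x y)
  have e : orc P n = (qPairs P n).map fun p => RtOp.oracle (qWires P n p.1 p.2) (vW P n p.1 p.2) := rfl
  funext j
  rw [e]
  unfold w₃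
  by_cases hj : IsSlot P n j
  · rw [if_pos hj]
    obtain ⟨hv, hs, hi⟩ := vW_of_isSlot P hj
    have hi' : (j - Wblk P n) % P.bM n < P.bOf n ((j - Wblk P n) / P.bM n) := hj.2.2
    have hmem : ((j - Wblk P n) / P.bM n, (j - Wblk P n) % P.bM n) ∈ qPairs P n := (mem_qPairs P n).2 ⟨hs, hi'⟩
    have := k1 _ hmem
    dsimp only at this
    rw [hv] at this
    rw [this, map_w₂_qWires P x y hs hi', ← hv, w₂_vW P x y hs hi]
    simp [ans]
  · rw [if_neg hj]
    refine k2 j fun p hp heq => hj ?_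
    obtain ⟨hs, hi⟩ := (mem_qPairs P n).1 hp
    rw [← heq]; exact isSlot_vW P hs hi

/-- **Stage 4**: after the second block — the read-out erased, data restored. [folklore] -/
def w₄ : ℕ → Bool := fun j => if Wblk P n ≤ j then w₃ P x y A j else w₁ P x y j

/-- Stage 4 is the block on stage 3 (frame rule and the involution). [cite: NielsenChuang2010, §3.2.5 (eq. (3.7))] -/
theorem clEval_blkC_w₃ : clEval (blkC P n) (w₃ P x y A) = w₄ P x y A := by
  have h3 : w₃ P x y A = fun j => if Wblk P n ≤ j then w₃ P x y A j else w₂ P x y j := by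
    funext j
    by_cases hj : Wblk P n ≤ j
    · rw [if_pos hj]
    · rw [if_neg hj]; unfold w₃; rw [if_neg (fun h => hj h.1)]
  rw [h3, clEval_blkC_ite, ← clEval_blkC_w₁, clEval_blkC_blkC]
  rfl

/-- The queried value slots as a function on all wires (zero elsewhere). [folklore] -/
def vbit : ℕ → Bool := fun j =>
  if IsSlot P n j then ans P y A ((j - Wblk P n) / P.bM n) ((j - Wblk P n) % P.bM n) else false

/-- **The final assignment**: data `x y` below, the answer bits in the queried value slots, zeros
elsewhere. [folklore] -/
def wF : ℕ → Bool := fun j => if j < P.DD n then w₀ P x y j else vbit P y A j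

/-- **Stage 5**: clearing the header gives the final assignment. [folklore] -/
theorem clEval_notsC_w₄ : clEval (notsC P n) (w₄ P x y A) = wF P x y A := by
  funext j
  rw [clEval_notsC_apply]
  unfold w₄ wF vbit w₃
  have hDW := DD_le_Wblk P n
  have hWH := Wblk_le_hBase P n
  by_cases h1 : j < P.DD n
  · rw [if_pos h1, if_neg (by omega), w₁, hbit_of_lt P (by omega)]; simp
  rw [if_neg h1]
  by_cases h2 : Wblk P n ≤ j
  · rw [if_pos h2]
    by_cases hsl : IsSlot P n j
    · rw [if_pos hsl, if_pos hsl, hbit_of_lt P hsl.2.1, Bool.xor_false]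
    · rw [if_neg hsl, if_neg hsl]
      unfold w₂
      rw [if_neg (not_lt.2 h2), w₁, w₀_of_le P x y (not_lt.1 h1), Bool.false_xor, Bool.xor_self]
  · rw [if_neg h2, if_neg (fun h : IsSlot P n j => h2 h.1), w₁, w₀_of_le P x y (not_lt.1 h1),
      hbit_of_lt P (by omega)]
    simp

/-- **The classical run of `V`** on `x y 0…0`, relative to `A`. [cite: AaronsonChen2017, App. 13 (p. 42)] -/
theorem ocEval_body : OSim.ocEval A (body P n) (w₀ P x y) = wF P x y A := by
  rw [body, OSim.ocEval_append, OSim.ocEval_append, OSim.ocEval_append, OSim.ocEval_append]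
  simp only [OSim.ocEval_map_cl]
  rw [clEval_notsC_w₀, clEval_blkC_w₁, ocEval_orc_w₂, clEval_blkC_w₃, clEval_notsC_w₄]

/-- **The work-register content written by `V`** on the coins `y`: the answer bits of the queried
value slots. [cite: AaronsonChen2017, App. 13 (p. 42)] -/
def Rw : QReg (mW P n) := fun l => vbit P y A (P.DD n + l)

/-- The label `x y ρ` extended to `ℕ`. [folklore] -/
theorem liftW_tri {k m : ℕ} (x : QReg n) (y : QReg k) (ρ : QReg m) (i : ℕ) :
    liftW (Kitaev1995.tri x y ρ) i = if h : i < n then x ⟨i, h⟩ else if h' : i < n + k then y ⟨i - n, by omega⟩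
      else if h'' : i < n + (k + m) then ρ ⟨i - n - k, by omega⟩ else false := by
  unfold liftW
  by_cases h1 : i < n
  · rw [dif_pos (by omega), dif_pos h1]
    exact Kitaev1995.tri_castAdd x y ρ ⟨i, h1⟩
  rw [dif_neg h1]
  by_cases h2 : i < n + k
  · rw [dif_pos (by omega), dif_pos h2]
    have : (⟨i, by omega⟩ : Fin (n + (k + m))) = coinWire n k m ⟨i - n, by omega⟩ := by
      ext; simp [val_coinWire]; omega
    rw [this, Kitaev1995.tri_coinWire]
  rw [dif_neg h2]
  by_cases h3 : i < n + (k + m)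
  · rw [dif_pos h3, dif_pos h3]
    have : (⟨i, h3⟩ : Fin (n + (k + m))) = Fin.natAdd n (Fin.natAdd k ⟨i - n - k, by omega⟩) := by
      ext; simp; omega
    rw [this, Kitaev1995.tri_work]
  · rw [dif_neg h3, dif_neg h3]

/-- **`V` maps `|x y 0…0⟩` to `|x y (Rw y)⟩`**: the classical block of Kitaev's circuit, relative to
the oracle. [cite: AaronsonChen2017, App. 13 (p. 42)] [cite: Kitaev1995, §3 (Remark 8, Lemma 8)] -/
theorem V_mulVec_coinInput :
    (V P n).toMatrix A *ᵥ basisState (coinInput x y) = basisState (Kitaev1995.tri x y (Rw P y A)) := by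
  rw [V_mulVec_basisState]
  congr 1
  funext p
  have hrun := congrFun (ocEval_body P x y A) p
  change OSim.ocEval A (body P n) (w₀ P x y) p = _
  rw [hrun, ← liftW_val (Kitaev1995.tri x y (Rw P y A)) p, liftW_tri]
  unfold wF
  by_cases h1 : (p : ℕ) < P.DD n
  · rw [if_pos h1]
    unfold w₀
    rw [liftW_val, Kitaev1995.coinInput_eq_tri, ← liftW_val (Kitaev1995.tri x y fun _ => false) p, liftW_tri]
    unfold Shape.DD at h1
    by_cases h2 : (p : ℕ) < n
    · rw [dif_pos h2, dif_pos h2]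
    · rw [dif_neg h2, dif_neg h2, dif_pos h1, dif_pos h1]
  · rw [if_neg h1]
    have h1' : ¬ (p : ℕ) < n + P.K n := h1
    rw [dif_neg (by omega), dif_neg h1', dif_pos p.isLt]
    unfold Rw
    congr 1
    simp only [Shape.DD]; omega

end Run2

end Lem75Q

end Literature.Barriers.QuantumAdvantage

end
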